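import Literature.MathematicalPhysics.QuantumFieldTheory.Balaban1983to89.B1Eq324BenfattoKernelSect5TupleClusters
import Literature.MathematicalPhysics.QuantumFieldTheory.Balaban1983to89.B1Eq324BenfattoSect5FreeCumulants
import Literature.MathematicalPhysics.QuantumFieldTheory.Balaban1983to89.B1Eq324BenfattoSect5SlotMasses
import Literature.MathematicalPhysics.QuantumFieldTheory.Balaban1983to89.B1Eq324BenfattoKernelComparisonTwoMembers
import Literature.MathematicalPhysics.QuantumFieldTheory.Balaban1983to89.B1Eq324BenfattoKernelOfPrecision
import Literature.MathematicalPhysics.QuantumFieldTheory.Balaban1983to89.B1Eq324BenfattoSpecialisation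
import HarnessLib

/-!
# `Balaban1983to89.B1Eq324BenfattoKernelCumulantComparison` — [BenfattoEtAl1978] (4.6)–(4.7) p. 152, the square bracket
# `Σ_{k=1}^{t} 𝓔^T(H_J; k)/k!` UNDER TWO GAUSSIAN KERNEL FIELDS: `|Σ_k 𝓔^T_{𝒩(0,K₂)}(H_J;k)/k! − Σ_k 𝓔^T_{𝒩(0,K₁)}(H_J;k)/k!| ≤ ε·C(t, D, |J|·A, R)`
# from entrywise rows `|K₂ − K₁| ≤ ε`, `|K_i| ≤ R` on `J × J` — the CUMULANT-FUNCTIONAL HALF («E₂») of the comparison of two members of the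
# class of [Balaban1985BackgroundPropagators] Sect. E, PROVED (non-anchored form)

statement-level skeleton of published theorems with citation tags; proofs where landed; nothing here is a claim about the
Yang–Mills mass gap

WHY THIS MODULE (cell `pub-ymgap`, seat `dag-n08-c` gen 33, CLAIM-23; node N08 [Balaban1985UV3]; the [BenfattoEtAl1978] source chain behind the
(α)-row `h324`).  The class road delivers B1 (3.24) for the Gaussian field `μ_K` of every class member (`…KernelEq324.eq324_kernel_noPad`, seats
n08-d/n08-b/n08-c): `0 < ∫Π_Δχ̂ e^{H_J}dμ_K ∧ |log ∫Π_Δχ̂ e^{H_J}dμ_K − cumulantSum μ_K H_J t| ≤ C·η^κ·|I|`.  An APPROXIMATE presentation of a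
[Balaban1985UV3] step block by a member (n08-d's CHECK C out (T2) «comparison by images» of a wrapped covariance, or an IDENT presenting the pin's
precision only up to small rows) moves BOTH functionals of that statement; the (α)-socket's `…ClassSocketApprox.eq324_of_approx` (seat n08-w4)
accordingly eats two discrepancies: `E₁` for `log ∫` (supplied by `…KernelComparisonTwoMembers.integral_cutoffBoltzmann_bounds_of_rows`, seat
n08-w5) and `E₂` for the square bracket `cumulantSum`.  This file supplies `E₂`.  The engine is ALREADY in the tree: [BenfattoEtAl1978] (5.31)
«(error)» for tuple-class slots under TWO shifted kernel fields, `…KernelSect5TupleClusters.abs_ursellOf_tupleSums_shift_sub_shift_le` (seat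
n08-c gen 31: Wick's theorem with a source + the leg-wise telescoping of `…KernelSect5PolyClusters`), read here at `σ := Fin k`, EVERY class the
whole Hamiltonian `H_J` (`T j p := univ`), centres `u₁ = u₀ = 0`; `𝓔^T(H_J; k)` is the Ursell function of the product moments of `k` copies of
`H_J` (`…Sect5FreeCumulants.truncatedExp_eq_ursellOf_prod`), and the mass of `H_J`'s terms is `≤ A·|J|·C_mass` (`…Sect5SlotMasses.classSum_le_card_mul`).

THE PRINTED TEXT this reads (p. 152): (4.6)–(4.7) carry the same square bracket `[Σ_{k=1}^{t} 𝓔̂₀^T(H_J;k)/k!]` on both sides, `𝓔̂₀^T` w.r.t. the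
free field `P̂₀`; p. 153 Remark 1: *"the truncated expectations … are always taken with respect to the unconditioned P̂₀"*; (5.31) p. 158 «(error)»
is print's own two-field comparison (conditioned versus free) of joint truncated expectations, whose typed kernel edition is the engine above.

DICTIONARY.  `𝒩(0,K_i)` ↦ `gaussianFieldOfKernel K_i` (`K_i` positive semidefinite on `Q₀ = Site d`); `𝓔^T_{K}(H;k)` ↦ `truncatedExp (gaussianFieldOfKernel K) H k`;
the square bracket ↦ `cumulantSum (gaussianFieldOfKernel K) H t`; `H_J` ↦ `hamiltonian s D ϰ a J`; `A` ↦ `coefSup s D a J`; rows: R0 `hK_i : IsPosSemidefKernel K_i`,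
R1 `K_i y y ≤ c_i` (integrability of the polynomial slots), R2 `∀ x y ∈ J, |K_i x y| ≤ R` (`R ≥ 1`), R3 `∀ x y ∈ J, |K₂ x y − K₁ x y| ≤ ε` (`ε ≥ 0`); the MASS
of the terms of `H_J`: `𝓜 := Σ_{p∈Icc 1 s}Σ_{Δ : Fin p → J}Σ_{n admissible}|A^n_Δ|e^{−(ϰ/2)d(Δ)}` (displayed as a hypothesis `𝓜 ≤ M` in §2–§3; §1 bounds it by
`A·|J|·C_mass(ϰ,s,D,d)`).  Members of the class (§4): `(Λ, A_i, K_i)` with `K_i` the zero-extended `A_i⁻¹` (`…KernelOfPrecision`), the row hypotheses of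
`…KernelComparisonTwoMembers` (`Σ_{e′}|A₂ e e′ − A₁ e e′| ≤ r`) and absolute row sums of the covariances `Σ_{e′}|A_i⁻¹ e e′| ≤ M_i`
(`…ClassAppendixC.sum_abs_inv_apply_le` at class data).

WHAT IS PROVED (theorems only; no definition, no instance, no notation, no named fact, no `sorry`; axioms standard).
* §1 `hamiltonian_eq_tupleSum_univ` (`H_J` as the tuple-class sum over ALL `J`-tuples, `…Sect5Eq511.term`); ★ `tupleMass_univ_le`
  (`𝓜 ≤ A·|J|·Σ_{p∈Icc 1 s}|admissible p D|·K_d(ϰ/2p)^{p−1}`).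
* §2 ★★ `abs_truncatedExp_kernel_sub_kernel_le` — rows R0–R3, `𝓜 ≤ M`, `k ≥ 1`:
  `|𝓔^T_{K₂}(H_J;k) − 𝓔^T_{K₁}(H_J;k)| ≤ M^k·2^{kD}·2^{2^{kD}}·(kD)·R^{kD}·ε`.
* §3 ★★★ `abs_cumulantSum_kernel_sub_kernel_le` — the square bracket: `|cumulantSum μ_{K₂} H_J t − cumulantSum μ_{K₁} H_J t| ≤
  ε·Σ_{k=1}^{t} M^k·2^{kD}2^{2^{kD}}(kD)R^{kD}/k!` (= the letter `E₂` of `…ClassSocketApprox.eq324_of_approx` for two kernel presentations of one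
  step block); `abs_cumulantSum_kernel_sub_kernel_le_coefSup` (the same with `M := A·|J|·C_mass`).
* §4 (two class MEMBERS on one window, precision currency) `abs_kernel_sub_kernel_le_of_rows` (`|K₂ x y − K₁ x y| ≤ M₂·r·M₁` on `Λ × Λ`, `0` off it —
  `…KernelComparisonTwoMembers.rows_inv_sub_inv_le` BY NAME), `abs_kernel_le_of_rows` (`|K_i x y| ≤ M_i`), ★★★ `abs_cumulantSum_member_sub_member_le`
  (§3 at `R := max 1 (max M₁ M₂)`, `ε := M₂·r·M₁`, `J ⊆ Λ`; `A_i` positive definite, uniform `r`), ★★★ `abs_cumulantSum_member_sub_member_le_of_rows`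
  (the same in the EXACT row currency of `…KernelComparisonTwoMembers`: `A_i` symmetric, `A₁` `γ`-coercive, `r_e ≤ r_max < γ` — one row datum feeds
  `E₁` there and `E₂` here).

HONEST SCOPE / NOT HERE.  (i) NON-ANCHORED: the bound carries `M^k ≍ (|J|·A)^k`, not the extensive `|J|·A^k` — an anchored edition (row 5
`…KernelSect5TupleClustersAnchored` with a decay-weighted `ε`) is NOT claimed; so `E₂` is small only where `ε·(|J|·A·C)^t` is (e.g. a cut-open torus
image whose wrap couplings give `ε ≍ e^{−κP/2}` against `|J| ≤ P^d`: every period `P` above a constant threshold; NOT the last wrapped steps).  (ii) Rows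
DISPLAYED, not discharged; at class data R1/R2/`M_i` come from `…KernelOfPrecision` / `…ClassAppendixC` (instantiation's business).  (iii) A TOOL for
approximate presentations — NOT the IDENT, NOT a decision on CHECK C, NOT a statement about [Balaban1985UV3]'s fluctuation covariance; `PrintedUV3V` /
row `h324c` NOT discharged; N08 NOT discharged; count-neutral; nothing about d = 4, the continuum, OS axioms, a mass gap or the Clay problem.
-/

open MeasureTheory Finset
open scoped BigOperators NNReal

namespace Literature.MathematicalPhysics.QuantumFieldTheory.Balaban1983to89.B1Eq324BenfattoKernelCumulantComparison

open _root_.MeasureTheory _root_.ProbabilityTheory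
open Literature.Probability.LatticeModels (ursellOf)
open Literature.MathematicalPhysics.QuantumFieldTheory
open Literature.MathematicalPhysics.QuantumFieldTheory.Balaban1983to89.B1Eq324BenfattoLemma
open Literature.MathematicalPhysics.QuantumFieldTheory.Balaban1983to89.B1Eq324BenfattoConnLength (connLength_nonneg)
open Literature.MathematicalPhysics.QuantumFieldTheory.Balaban1983to89.B1Eq324BenfattoSpecialisation (coefSup_nonneg abs_coef_le_coefSup)
open Literature.MathematicalPhysics.QuantumFieldTheory.Balaban1983to89.B1Eq324BenfattoSect5Eq511 (term)
open Literature.MathematicalPhysics.QuantumFieldTheory.Balaban1983to89.B1Eq324BenfattoSect5SlotMasses (classSum_le_card_mul)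
open Literature.MathematicalPhysics.QuantumFieldTheory.Balaban1983to89.B1Eq324BenfattoSect5FreeCumulants (truncatedExp_eq_ursellOf_prod)
open Literature.MathematicalPhysics.QuantumFieldTheory.Balaban1983to89.B1Eq324BenfattoKernelSect5TupleClusters
  (abs_ursellOf_tupleSums_shift_sub_shift_le)
open Literature.MathematicalPhysics.QuantumFieldTheory.Balaban1983to89.B1Eq324BenfattoKernelComparisonTwoMembers (rows_inv_sub_inv_le coercive_of_rows)
open Literature.MathematicalPhysics.QuantumFieldTheory.Balaban1983to89.B1Eq324BenfattoClassAppendixC (posDef_of_coercive)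
open Literature.MathematicalPhysics.QuantumFieldTheory.Balaban1983to89.B1Eq324BenfattoKernelOfPrecision
  (kernel_apply_of_mem kernel_eq_zero_of_not_mem_left kernel_eq_zero_of_not_mem_right isPosSemidefKernel_kernel)

variable {d : ℕ} {K₁ K₂ : B1Eq324BenfattoLemma.Site d → B1Eq324BenfattoLemma.Site d → ℝ}
variable {s D : ℕ} {ϰ : ℝ} {a : Coef d} {J : Finset (B1Eq324BenfattoLemma.Site d)}

/-! ## §1  `H_J` as the tuple-class sum over all `J`-tuples, and the mass of its terms -/

/-- `H_J (4.5)` IS the tuple-class sum over ALL `J`-tuples of the (5.5)-summands `term` (one class, every tuple). [cite: BenfattoEtAl1978, (4.5) p.152 and (5.5) p.154] -/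
theorem hamiltonian_eq_tupleSum_univ (s D : ℕ) (ϰ : ℝ) (a : Coef d) (J : Finset (B1Eq324BenfattoLemma.Site d))
    (z : B1Eq324BenfattoLemma.Site d → ℝ) :
    hamiltonian s D ϰ a J z =
      ∑ p ∈ Finset.Icc 1 s, ∑ Δ ∈ (Finset.univ : Finset (Fin p → J)), ∑ n ∈ admissible p D, term ϰ a z p Δ n := rfl

/-- Shifting a measure on configurations by the zero centre does nothing. [folklore] -/
private theorem map_add_zero_eq (μ : Measure (B1Eq324BenfattoLemma.Site d → ℝ)) :
    (μ.map fun (ζ : B1Eq324BenfattoLemma.Site d → ℝ) (y : B1Eq324BenfattoLemma.Site d) => (0 : ℝ) + ζ y) = μ := by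
  have h : (fun (ζ : B1Eq324BenfattoLemma.Site d → ℝ) (y : B1Eq324BenfattoLemma.Site d) => (0 : ℝ) + ζ y) = id := by
    funext ζ y
    simp
  rw [h, Measure.map_id]

/-- ★ **THE MASS OF THE TERMS OF `H_J`**: `Σ_{p∈Icc 1 s}Σ_{Δ : Fin p → J}Σ_{n admissible}|A^n_Δ|e^{−(ϰ/2)d(Δ)} ≤ A·|J|·Σ_{p∈Icc 1 s}|admissible p D|·K_d(ϰ/2p)^{p−1}`
(`A = coefSup`, `ϰ > 0`): anchor every tuple at its first tessera and sum the others freely (`…Sect5SlotMasses.classSum_le_card_mul` with the class of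
ALL tuples and the region `J`). [cite: BenfattoEtAl1978, (4.5) p.152, (5.24) p.157] -/
theorem tupleMass_univ_le (hϰ : 0 < ϰ) (s D : ℕ) (a : Coef d) (J : Finset (B1Eq324BenfattoLemma.Site d)) :
    ∑ p ∈ Finset.Icc 1 s, ∑ Δ ∈ (Finset.univ : Finset (Fin p → J)), ∑ n ∈ admissible p D,
        |a p (fun i => (Δ i : B1Eq324BenfattoLemma.Site d)) n| *
          Real.exp (-(ϰ / 2) * connLength fun i => (Δ i : B1Eq324BenfattoLemma.Site d)) ≤
      coefSup s D a J * J.card * ∑ p ∈ Finset.Icc 1 s, ((admissible p D).card : ℝ) *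
        ((2 / (1 - Real.exp (-(ϰ / 2 / (p : ℕ) / Real.sqrt d))) * Real.exp (ϰ / 2 / (p : ℕ) / Real.sqrt d)) ^ d) ^ (p - 1) := by
  refine classSum_le_card_mul (s := s) (D := D) (Jr := J) (half_pos hϰ) (coefSup_nonneg s D a J) (fun p => Finset.univ) J
    (fun p _ Δ _ i => (Δ i).2) _ fun p hp Δ _ n hn => ?_
  rw [neg_mul]
  exact mul_le_mul_of_nonneg_right (abs_coef_le_coefSup s D a J hp Δ hn) (Real.exp_pos _).le

/-! ## §2  One order: `|𝓔^T_{K₂}(H_J;k) − 𝓔^T_{K₁}(H_J;k)|` -/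

/-- ★★ **TWO KERNELS, ONE ORDER.**  For positive semidefinite `K₁, K₂` on `Q₀` with bounded diagonals (R1), `|K_i x y| ≤ R` and `|K₂ x y − K₁ x y| ≤ ε` on
`J × J` (`R ≥ 1`, `ε ≥ 0`), the mass of `H_J`'s terms `≤ M`, and `k ≥ 1`:
`|𝓔^T_{𝒩(0,K₂)}(H_J;k) − 𝓔^T_{𝒩(0,K₁)}(H_J;k)| ≤ M^k·2^{kD}·2^{2^{kD}}·(kD)·R^{kD}·ε` — [2] (5.31) «(error)» for two kernel fields
(`…KernelSect5TupleClusters.abs_ursellOf_tupleSums_shift_sub_shift_le`) at `σ = Fin k`, every class the whole `H_J`, centres `0`.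
[cite: BenfattoEtAl1978, (5.31) p.158, (2.7) p.147, (4.6)–(4.7) p.152] -/
theorem abs_truncatedExp_kernel_sub_kernel_le (hK₁ : IsPosSemidefKernel K₁) (hK₂ : IsPosSemidefKernel K₂)
    {c₁ c₂ : ℝ≥0} (hdiag₁ : ∀ y, K₁ y y ≤ c₁) (hdiag₂ : ∀ y, K₂ y y ≤ c₂)
    {R ε : ℝ} (hR : 1 ≤ R) (hε : 0 ≤ ε)
    (hR₁ : ∀ x ∈ J, ∀ y ∈ J, |K₁ x y| ≤ R) (hR₂ : ∀ x ∈ J, ∀ y ∈ J, |K₂ x y| ≤ R)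
    (hε₂₁ : ∀ x ∈ J, ∀ y ∈ J, |K₂ x y - K₁ x y| ≤ ε)
    {M : ℝ} (hM : ∑ p ∈ Finset.Icc 1 s, ∑ Δ ∈ (Finset.univ : Finset (Fin p → J)), ∑ n ∈ admissible p D,
        |a p (fun i => (Δ i : B1Eq324BenfattoLemma.Site d)) n| *
          Real.exp (-(ϰ / 2) * connLength fun i => (Δ i : B1Eq324BenfattoLemma.Site d)) ≤ M)
    {k : ℕ} (hk : 0 < k) :
    |truncatedExp (gaussianFieldOfKernel K₂) (hamiltonian s D ϰ a J) k -
        truncatedExp (gaussianFieldOfKernel K₁) (hamiltonian s D ϰ a J) k| ≤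
      M ^ k * (2 ^ (k * D) * 2 ^ 2 ^ (k * D) * ((k * D : ℕ) * R ^ (k * D) * ε)) := by
  classical
  haveI : Nonempty (Fin k) := ⟨⟨0, hk⟩⟩
  -- the engine: (5.31) for two shifted kernel fields, every class = all tuples, centres `0`
  have h := abs_ursellOf_tupleSums_shift_sub_shift_le (s := s) (D := D) (ϰ := ϰ) (a := a) (Jr := J) (σ := Fin k)
    hK₂ hK₁ (fun _ => (0 : ℝ)) (fun _ => (0 : ℝ)) hdiag₂ hdiag₁ (fun _ p => (Finset.univ : Finset (Fin p → J))) hR hε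
    (fun j p _ Δ _ i => by rw [abs_zero]; exact zero_le_one.trans hR)
    (fun j p _ Δ _ i => by rw [abs_zero]; exact zero_le_one.trans hR)
    (fun j j' p _ p' _ Δ _ Δ' _ i i' => hR₂ _ (Δ i).2 _ (Δ' i').2)
    (fun j j' p _ p' _ Δ _ Δ' _ i i' => hR₁ _ (Δ i).2 _ (Δ' i').2)
    (fun j p _ Δ _ i => by rw [sub_self, abs_zero]; exact hε)
    (fun j j' p _ p' _ Δ _ Δ' _ i i' => hε₂₁ _ (Δ i).2 _ (Δ' i').2)
  rw [map_add_zero_eq, map_add_zero_eq, Fintype.card_fin, Finset.prod_const, Finset.card_univ, Fintype.card_fin] at h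
  -- the two truncated expectations ARE those Ursell functions
  have h₂ : truncatedExp (gaussianFieldOfKernel K₂) (hamiltonian s D ϰ a J) k =
      ursellOf (fun P : Finset (Fin k) => ∫ z, ∏ _j ∈ P,
        (∑ p ∈ Finset.Icc 1 s, ∑ Δ ∈ (Finset.univ : Finset (Fin p → J)), ∑ n ∈ admissible p D, term ϰ a z p Δ n)
          ∂(gaussianFieldOfKernel K₂)) Finset.univ := by
    rw [truncatedExp_eq_ursellOf_prod]; rfl
  have h₁ : truncatedExp (gaussianFieldOfKernel K₁) (hamiltonian s D ϰ a J) k =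
      ursellOf (fun P : Finset (Fin k) => ∫ z, ∏ _j ∈ P,
        (∑ p ∈ Finset.Icc 1 s, ∑ Δ ∈ (Finset.univ : Finset (Fin p → J)), ∑ n ∈ admissible p D, term ϰ a z p Δ n)
          ∂(gaussianFieldOfKernel K₁)) Finset.univ := by
    rw [truncatedExp_eq_ursellOf_prod]; rfl
  rw [h₂, h₁]
  refine h.trans ?_
  have hC : 0 ≤ 2 ^ (k * D) * 2 ^ 2 ^ (k * D) * ((k * D : ℕ) * R ^ (k * D) * ε) := by
    have hR0 : 0 ≤ R := zero_le_one.trans hR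
    positivity
  have hmass0 : 0 ≤ ∑ p ∈ Finset.Icc 1 s, ∑ Δ ∈ (Finset.univ : Finset (Fin p → J)), ∑ n ∈ admissible p D,
      |a p (fun i => (Δ i : B1Eq324BenfattoLemma.Site d)) n| *
        Real.exp (-(ϰ / 2) * connLength fun i => (Δ i : B1Eq324BenfattoLemma.Site d)) :=
    Finset.sum_nonneg fun _ _ => Finset.sum_nonneg fun _ _ => Finset.sum_nonneg fun _ _ =>
      mul_nonneg (abs_nonneg _) (Real.exp_pos _).le
  exact mul_le_mul_of_nonneg_right (pow_le_pow_left₀ hmass0 hM k) hC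

/-! ## §3  The square bracket `Σ_{k=1}^{t} 𝓔^T(H_J;k)/k!` under two kernels: the letter `E₂` -/

/-- ★★★ **THE SQUARE BRACKET OF (4.6)–(4.7) UNDER TWO KERNELS** («E₂»): rows as in §2; then
`|cumulantSum 𝒩(0,K₂) H_J t − cumulantSum 𝒩(0,K₁) H_J t| ≤ ε·Σ_{k=1}^{t} M^k·2^{kD}·2^{2^{kD}}·(kD)·R^{kD}/k!`.
[cite: BenfattoEtAl1978, (4.6)–(4.7) p.152, Remark 1 p.153, (5.31) p.158] -/
theorem abs_cumulantSum_kernel_sub_kernel_le (hK₁ : IsPosSemidefKernel K₁) (hK₂ : IsPosSemidefKernel K₂)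
    {c₁ c₂ : ℝ≥0} (hdiag₁ : ∀ y, K₁ y y ≤ c₁) (hdiag₂ : ∀ y, K₂ y y ≤ c₂)
    {R ε : ℝ} (hR : 1 ≤ R) (hε : 0 ≤ ε)
    (hR₁ : ∀ x ∈ J, ∀ y ∈ J, |K₁ x y| ≤ R) (hR₂ : ∀ x ∈ J, ∀ y ∈ J, |K₂ x y| ≤ R)
    (hε₂₁ : ∀ x ∈ J, ∀ y ∈ J, |K₂ x y - K₁ x y| ≤ ε)
    {M : ℝ} (hM : ∑ p ∈ Finset.Icc 1 s, ∑ Δ ∈ (Finset.univ : Finset (Fin p → J)), ∑ n ∈ admissible p D,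
        |a p (fun i => (Δ i : B1Eq324BenfattoLemma.Site d)) n| *
          Real.exp (-(ϰ / 2) * connLength fun i => (Δ i : B1Eq324BenfattoLemma.Site d)) ≤ M)
    (t : ℕ) :
    |cumulantSum (gaussianFieldOfKernel K₂) (hamiltonian s D ϰ a J) t -
        cumulantSum (gaussianFieldOfKernel K₁) (hamiltonian s D ϰ a J) t| ≤
      ε * ∑ k ∈ Finset.Icc 1 t, M ^ k * (2 ^ (k * D) * 2 ^ 2 ^ (k * D) * ((k * D : ℕ) * R ^ (k * D))) / (k.factorial : ℝ) := by
  unfold cumulantSum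
  rw [← Finset.sum_sub_distrib, Finset.mul_sum]
  refine (Finset.abs_sum_le_sum_abs _ _).trans (Finset.sum_le_sum fun k hk => ?_)
  have hk1 : 0 < k := (Finset.mem_Icc.1 hk).1
  have hfac : (0 : ℝ) < (k.factorial : ℝ) := by exact_mod_cast Nat.factorial_pos k
  rw [← sub_div, abs_div, abs_of_pos hfac]
  have h := abs_truncatedExp_kernel_sub_kernel_le (s := s) (D := D) (ϰ := ϰ) (a := a) (J := J)
    hK₁ hK₂ hdiag₁ hdiag₂ hR hε hR₁ hR₂ hε₂₁ hM hk1
  calc |truncatedExp (gaussianFieldOfKernel K₂) (hamiltonian s D ϰ a J) k -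
          truncatedExp (gaussianFieldOfKernel K₁) (hamiltonian s D ϰ a J) k| / (k.factorial : ℝ)
      ≤ M ^ k * (2 ^ (k * D) * 2 ^ 2 ^ (k * D) * ((k * D : ℕ) * R ^ (k * D) * ε)) / (k.factorial : ℝ) :=
        div_le_div_of_nonneg_right h hfac.le
    _ = ε * (M ^ k * (2 ^ (k * D) * 2 ^ 2 ^ (k * D) * ((k * D : ℕ) * R ^ (k * D))) / (k.factorial : ℝ)) := by ring

/-- **`E₂` WITH THE MASS DISCHARGED BY `coefSup`** (`ϰ > 0`): the same with `M := A·|J|·Σ_{p∈Icc 1 s}|admissible p D|·K_d(ϰ/2p)^{p−1}` (§1).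
[cite: BenfattoEtAl1978, (4.6)–(4.7) p.152, (5.31) p.158, (5.24) p.157] -/
theorem abs_cumulantSum_kernel_sub_kernel_le_coefSup (hK₁ : IsPosSemidefKernel K₁) (hK₂ : IsPosSemidefKernel K₂)
    {c₁ c₂ : ℝ≥0} (hdiag₁ : ∀ y, K₁ y y ≤ c₁) (hdiag₂ : ∀ y, K₂ y y ≤ c₂)
    {R ε : ℝ} (hR : 1 ≤ R) (hε : 0 ≤ ε)
    (hR₁ : ∀ x ∈ J, ∀ y ∈ J, |K₁ x y| ≤ R) (hR₂ : ∀ x ∈ J, ∀ y ∈ J, |K₂ x y| ≤ R)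
    (hε₂₁ : ∀ x ∈ J, ∀ y ∈ J, |K₂ x y - K₁ x y| ≤ ε) (hϰ : 0 < ϰ) (t : ℕ) :
    |cumulantSum (gaussianFieldOfKernel K₂) (hamiltonian s D ϰ a J) t -
        cumulantSum (gaussianFieldOfKernel K₁) (hamiltonian s D ϰ a J) t| ≤
      ε * ∑ k ∈ Finset.Icc 1 t,
        (coefSup s D a J * J.card * ∑ p ∈ Finset.Icc 1 s, ((admissible p D).card : ℝ) *
          ((2 / (1 - Real.exp (-(ϰ / 2 / (p : ℕ) / Real.sqrt d))) * Real.exp (ϰ / 2 / (p : ℕ) / Real.sqrt d)) ^ d) ^ (p - 1)) ^ k *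
        (2 ^ (k * D) * 2 ^ 2 ^ (k * D) * ((k * D : ℕ) * R ^ (k * D))) / (k.factorial : ℝ) :=
  abs_cumulantSum_kernel_sub_kernel_le hK₁ hK₂ hdiag₁ hdiag₂ hR hε hR₁ hR₂ hε₂₁ (tupleMass_univ_le hϰ s D a J) t

/-! ## §4  Two class MEMBERS on one window (precision currency, the rows of `…KernelComparisonTwoMembers`) -/

section Members

variable {Λ : Finset (B1Eq324BenfattoLemma.Site d)} {A A₁ A₂ : Matrix Λ Λ ℝ}
  {K : B1Eq324BenfattoLemma.Site d → B1Eq324BenfattoLemma.Site d → ℝ}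

/-- **ENTRY ROW FROM AN ABSOLUTE ROW SUM**: a member kernel (zero-extended `A⁻¹`) with `Σ_{e′}|A⁻¹ e e′| ≤ M₀` has `|K x y| ≤ M₀` for `x ∈ Λ` and every `y`.
[cite: HornJohnson2013, §5.6 (maximum row sum norm); Balaban1985BackgroundPropagators, Sect. E p.428 (the class)] -/
theorem abs_kernel_le_of_rows
    (hK : ∀ x y, K x y = if h : x ∈ Λ ∧ y ∈ Λ then (A⁻¹ : Matrix Λ Λ ℝ) ⟨x, h.1⟩ ⟨y, h.2⟩ else 0)
    {M₀ : ℝ} (hM₀ : ∀ e : Λ, ∑ e' : Λ, |(A⁻¹ : Matrix Λ Λ ℝ) e e'| ≤ M₀) {x : B1Eq324BenfattoLemma.Site d} (hx : x ∈ Λ)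
    (y : B1Eq324BenfattoLemma.Site d) : |K x y| ≤ M₀ := by
  classical
  by_cases hy : y ∈ Λ
  · rw [kernel_apply_of_mem hK hx hy]
    exact (Finset.single_le_sum (f := fun e' : Λ => |(A⁻¹ : Matrix Λ Λ ℝ) ⟨x, hx⟩ e'|) (fun e' _ => abs_nonneg _)
      (Finset.mem_univ (⟨y, hy⟩ : Λ))).trans (hM₀ ⟨x, hx⟩)
  · rw [kernel_eq_zero_of_not_mem_right hK x hy, abs_zero]
    exact le_trans (Finset.sum_nonneg fun _ _ => abs_nonneg _) (hM₀ ⟨x, hx⟩)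

/-- **THE KERNEL DIFFERENCE OF TWO MEMBERS ON ONE WINDOW**: for positive-definite precisions `A₁, A₂` on `Λ` with covariances' absolute row sums `≤ M₁`, `≤ M₂`
and `Σ_{e′}|A₂ e e′ − A₁ e e′| ≤ r`, the zero-extended covariances differ entrywise by at most `M₂·r·M₁` (on rows `x ∈ Λ`; off `Λ` both vanish):
`A₂⁻¹ − A₁⁻¹ = A₂⁻¹(A₁ − A₂)A₁⁻¹` (`…KernelComparisonTwoMembers.rows_inv_sub_inv_le` BY NAME, an entry bounded by its row).
[cite: HornJohnson2013, §0.7.4 and §5.6; Balaban1985BackgroundPropagators, Sect. E p.428 (the class)] -/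
theorem abs_kernel_sub_kernel_le_of_rows (hA₁ : A₁.PosDef) (hA₂ : A₂.PosDef)
    (hK₁ : ∀ x y, K₁ x y = if h : x ∈ Λ ∧ y ∈ Λ then (A₁⁻¹ : Matrix Λ Λ ℝ) ⟨x, h.1⟩ ⟨y, h.2⟩ else 0)
    (hK₂ : ∀ x y, K₂ x y = if h : x ∈ Λ ∧ y ∈ Λ then (A₂⁻¹ : Matrix Λ Λ ℝ) ⟨x, h.1⟩ ⟨y, h.2⟩ else 0)
    {M₁ M₂ r : ℝ} (hM₁ : ∀ e : Λ, ∑ e' : Λ, |(A₁⁻¹ : Matrix Λ Λ ℝ) e e'| ≤ M₁)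
    (hM₂ : ∀ e : Λ, ∑ e' : Λ, |(A₂⁻¹ : Matrix Λ Λ ℝ) e e'| ≤ M₂)
    (hr : ∀ e : Λ, ∑ e' : Λ, |A₂ e e' - A₁ e e'| ≤ r) {x : B1Eq324BenfattoLemma.Site d} (hx : x ∈ Λ)
    (y : B1Eq324BenfattoLemma.Site d) : |K₂ x y - K₁ x y| ≤ M₂ * r * M₁ := by
  classical
  have hu₁ : IsUnit A₁.det := (Matrix.isUnit_iff_isUnit_det A₁).mp hA₁.isUnit
  have hu₂ : IsUnit A₂.det := (Matrix.isUnit_iff_isUnit_det A₂).mp hA₂.isUnit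
  have hrow := rows_inv_sub_inv_le hu₁ hu₂ hM₁ hM₂ hr ⟨x, hx⟩
  by_cases hy : y ∈ Λ
  · rw [kernel_apply_of_mem hK₂ hx hy, kernel_apply_of_mem hK₁ hx hy]
    exact (Finset.single_le_sum (f := fun e' : Λ => |(A₂⁻¹ : Matrix Λ Λ ℝ) ⟨x, hx⟩ e' - (A₁⁻¹ : Matrix Λ Λ ℝ) ⟨x, hx⟩ e'|)
      (fun e' _ => abs_nonneg _) (Finset.mem_univ (⟨y, hy⟩ : Λ))).trans hrow
  · rw [kernel_eq_zero_of_not_mem_right hK₂ x hy, kernel_eq_zero_of_not_mem_right hK₁ x hy, sub_zero, abs_zero]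
    exact le_trans (Finset.sum_nonneg fun _ _ => abs_nonneg _) hrow

/-- ★★★ **`E₂` FOR TWO CLASS MEMBERS ON ONE WINDOW.**  Members `(Λ, A₁, K₁)`, `(Λ, A₂, K₂)` (`Λ ≠ ∅`, `A_i` positive definite, `K_i` the zero-extended
`A_i⁻¹`) with covariance rows `Σ_{e′}|A_i⁻¹ e e′| ≤ M_i` and precision rows `Σ_{e′}|A₂ e e′ − A₁ e e′| ≤ r`, a Hamiltonian `H_J` with `J ⊆ Λ` whose terms have
mass `≤ M`: `|cumulantSum 𝒩(0,K₂) H_J t − cumulantSum 𝒩(0,K₁) H_J t| ≤ (M₂·r·M₁)·Σ_{k=1}^{t} M^k·2^{kD}2^{2^{kD}}(kD)·(max 1 (max M₁ M₂))^{kD}/k!` — §3 at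
`R := max 1 (max M₁ M₂)`, `ε := M₂·r·M₁`. [cite: BenfattoEtAl1978, (4.6)–(4.7) p.152, (5.31) p.158; Balaban1985BackgroundPropagators, Sect. E p.428 (the class)] -/
theorem abs_cumulantSum_member_sub_member_le (hΛ : Λ.Nonempty) (hA₁ : A₁.PosDef) (hA₂ : A₂.PosDef)
    (hK₁ : ∀ x y, K₁ x y = if h : x ∈ Λ ∧ y ∈ Λ then (A₁⁻¹ : Matrix Λ Λ ℝ) ⟨x, h.1⟩ ⟨y, h.2⟩ else 0)
    (hK₂ : ∀ x y, K₂ x y = if h : x ∈ Λ ∧ y ∈ Λ then (A₂⁻¹ : Matrix Λ Λ ℝ) ⟨x, h.1⟩ ⟨y, h.2⟩ else 0)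
    {M₁ M₂ r : ℝ} (hM₁ : ∀ e : Λ, ∑ e' : Λ, |(A₁⁻¹ : Matrix Λ Λ ℝ) e e'| ≤ M₁)
    (hM₂ : ∀ e : Λ, ∑ e' : Λ, |(A₂⁻¹ : Matrix Λ Λ ℝ) e e'| ≤ M₂)
    (hr : ∀ e : Λ, ∑ e' : Λ, |A₂ e e' - A₁ e e'| ≤ r) (hJ : J ⊆ Λ)
    {M : ℝ} (hM : ∑ p ∈ Finset.Icc 1 s, ∑ Δ ∈ (Finset.univ : Finset (Fin p → J)), ∑ n ∈ admissible p D,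
        |a p (fun i => (Δ i : B1Eq324BenfattoLemma.Site d)) n| *
          Real.exp (-(ϰ / 2) * connLength fun i => (Δ i : B1Eq324BenfattoLemma.Site d)) ≤ M)
    (t : ℕ) :
    |cumulantSum (gaussianFieldOfKernel K₂) (hamiltonian s D ϰ a J) t -
        cumulantSum (gaussianFieldOfKernel K₁) (hamiltonian s D ϰ a J) t| ≤
      (M₂ * r * M₁) * ∑ k ∈ Finset.Icc 1 t,
        M ^ k * (2 ^ (k * D) * 2 ^ 2 ^ (k * D) * ((k * D : ℕ) * (max 1 (max M₁ M₂)) ^ (k * D))) / (k.factorial : ℝ) := by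
  classical
  obtain ⟨e₀, he₀⟩ := hΛ
  have hM₁0 : 0 ≤ M₁ := le_trans (Finset.sum_nonneg fun _ _ => abs_nonneg _) (hM₁ ⟨e₀, he₀⟩)
  have hM₂0 : 0 ≤ M₂ := le_trans (Finset.sum_nonneg fun _ _ => abs_nonneg _) (hM₂ ⟨e₀, he₀⟩)
  have hr0 : 0 ≤ r := le_trans (Finset.sum_nonneg fun _ _ => abs_nonneg _) (hr ⟨e₀, he₀⟩)
  -- diagonal rows (integrability): `K_i y y ≤ max M_i 0`
  have hdiag₁ : ∀ y, K₁ y y ≤ (M₁.toNNReal : ℝ) := by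
    intro y
    rw [Real.coe_toNNReal _ hM₁0]
    by_cases hy : y ∈ Λ
    · exact (le_abs_self _).trans (abs_kernel_le_of_rows hK₁ hM₁ hy y)
    · rw [kernel_eq_zero_of_not_mem_left hK₁ hy y]; exact hM₁0
  have hdiag₂ : ∀ y, K₂ y y ≤ (M₂.toNNReal : ℝ) := by
    intro y
    rw [Real.coe_toNNReal _ hM₂0]
    by_cases hy : y ∈ Λ
    · exact (le_abs_self _).trans (abs_kernel_le_of_rows hK₂ hM₂ hy y)
    · rw [kernel_eq_zero_of_not_mem_left hK₂ hy y]; exact hM₂0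
  exact abs_cumulantSum_kernel_sub_kernel_le (isPosSemidefKernel_kernel hK₁ hA₁) (isPosSemidefKernel_kernel hK₂ hA₂) hdiag₁ hdiag₂
    (le_max_left _ _) (mul_nonneg (mul_nonneg hM₂0 hr0) hM₁0)
    (fun x hx y _ => (abs_kernel_le_of_rows hK₁ hM₁ (hJ hx) y).trans ((le_max_left _ _).trans (le_max_right _ _)))
    (fun x hx y _ => (abs_kernel_le_of_rows hK₂ hM₂ (hJ hx) y).trans ((le_max_right _ _).trans (le_max_right _ _)))
    (fun x hx y _ => abs_kernel_sub_kernel_le_of_rows hA₁ hA₂ hK₁ hK₂ hM₁ hM₂ hr (hJ hx) y) hM t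

/-- ★★★ **`E₂` IN THE EXACT ROW CURRENCY OF `…KernelComparisonTwoMembers`** (so ONE row datum feeds `E₁` there and `E₂` here): `A₁, A₂` symmetric, `A₁`
`γ`-coercive (`γ > 0`), `Σ_{e′}|A₂ e e′ − A₁ e e′| ≤ r_e ≤ r_max < γ` (then both are positive definite, `…TwoMembers.coercive_of_rows` +
`…ClassAppendixC.posDef_of_coercive`), covariance rows `Σ_{e′}|A_i⁻¹ e e′| ≤ M_i`, `Λ ≠ ∅`, `J ⊆ Λ`, mass `≤ M`:
`|cumulantSum 𝒩(0,K₂) H_J t − cumulantSum 𝒩(0,K₁) H_J t| ≤ (M₂·r_max·M₁)·Σ_{k=1}^{t} M^k·2^{kD}2^{2^{kD}}(kD)·(max 1 (max M₁ M₂))^{kD}/k!`.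
[cite: BenfattoEtAl1978, (4.6)–(4.7) p.152, (5.31) p.158; Balaban1985BackgroundPropagators, Sect. E p.428 (the class); HornJohnson2013, Thm 4.3.1, §5.6] -/
theorem abs_cumulantSum_member_sub_member_le_of_rows (hΛ : Λ.Nonempty)
    (hA₁ : ∀ e e', A₁ e e' = A₁ e' e) (hA₂ : ∀ e e', A₂ e e' = A₂ e' e) {γ rmax : ℝ} (hγ0 : 0 < γ) (r : Λ → ℝ)
    (hγ : ∀ x : Λ → ℝ, γ * ∑ e, x e ^ 2 ≤ ∑ e, ∑ e', A₁ e e' * x e * x e')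
    (hr : ∀ e, ∑ e', |A₂ e e' - A₁ e e'| ≤ r e) (hrmax : ∀ e, r e ≤ rmax) (hγr : rmax < γ)
    (hK₁ : ∀ x y, K₁ x y = if h : x ∈ Λ ∧ y ∈ Λ then (A₁⁻¹ : Matrix Λ Λ ℝ) ⟨x, h.1⟩ ⟨y, h.2⟩ else 0)
    (hK₂ : ∀ x y, K₂ x y = if h : x ∈ Λ ∧ y ∈ Λ then (A₂⁻¹ : Matrix Λ Λ ℝ) ⟨x, h.1⟩ ⟨y, h.2⟩ else 0)
    {M₁ M₂ : ℝ} (hM₁ : ∀ e : Λ, ∑ e' : Λ, |(A₁⁻¹ : Matrix Λ Λ ℝ) e e'| ≤ M₁)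
    (hM₂ : ∀ e : Λ, ∑ e' : Λ, |(A₂⁻¹ : Matrix Λ Λ ℝ) e e'| ≤ M₂) (hJ : J ⊆ Λ)
    {M : ℝ} (hM : ∑ p ∈ Finset.Icc 1 s, ∑ Δ ∈ (Finset.univ : Finset (Fin p → J)), ∑ n ∈ admissible p D,
        |a p (fun i => (Δ i : B1Eq324BenfattoLemma.Site d)) n| *
          Real.exp (-(ϰ / 2) * connLength fun i => (Δ i : B1Eq324BenfattoLemma.Site d)) ≤ M)
    (t : ℕ) :
    |cumulantSum (gaussianFieldOfKernel K₂) (hamiltonian s D ϰ a J) t -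
        cumulantSum (gaussianFieldOfKernel K₁) (hamiltonian s D ϰ a J) t| ≤
      (M₂ * rmax * M₁) * ∑ k ∈ Finset.Icc 1 t,
        M ^ k * (2 ^ (k * D) * 2 ^ 2 ^ (k * D) * ((k * D : ℕ) * (max 1 (max M₁ M₂)) ^ (k * D))) / (k.factorial : ℝ) := by
  have hγ' : 0 < γ - rmax := by linarith
  have hA₁pd : A₁.PosDef := posDef_of_coercive hA₁ hγ0 hγ
  have hA₂pd : A₂.PosDef := posDef_of_coercive hA₂ hγ' (coercive_of_rows hA₁ hA₂ r hγ hr hrmax)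
  exact abs_cumulantSum_member_sub_member_le hΛ hA₁pd hA₂pd hK₁ hK₂ hM₁ hM₂ (fun e => (hr e).trans (hrmax e)) hJ hM t

end Members

end Literature.MathematicalPhysics.QuantumFieldTheory.Balaban1983to89.B1Eq324BenfattoKernelCumulantComparison
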